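import Summits.BirchSwinnertonDyer.BirchSwinnertonDyer.Theorems.SmallImageMuTransferMuTransferX9UniversalNormsTools
import Literature.NumberTheory.EllipticCurves.ZpExtensionUnramifiedProofs
import Literature.NumberTheory.EllipticCurves.IsogenyFrobeniusTraceProofs
import Literature.NumberTheory.GaloisRepresentations.ContinuousCorestrictionResNormal
import Literature.NumberTheory.GaloisRepresentations.ConjugationDescent
import Summits.BirchSwinnertonDyer.Rank1Residual.GaloisImage.KolyvaginDerivativeNormRelation
import Summits.BirchSwinnertonDyer.Rank1Residual.GaloisImage.KolyvaginDerivativeUnramifiedClass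
import HarnessLib

/-!
# K6 crux `MuTransferX9` (stmt-BirchSwinnertonDyer-19276), named fact F2
# `Kato2004.mem_pSmul_of_red_eq_zero` (aside 19844 `KatoReductionModPKernel`): Kato's Lemma 8.5 (2) in
# the pin's currency — a norm-compatible family along the cyclotomic `ℤ_p`-tower whose `p`-multiples are
# integral is itself integral

Cell `bsd-smallim`, seat `bsd-smallim-k6-lur-a` (gen 2).  THEOREMS ONLY (no definition, no named fact,
no sorry).  Route `SmallImageMuTransfer`, crux 19276: after the closure of `MuTransferX9Core` (k6-c2
p476037) the deciding crux holds modulo three published named facts F1/F2/F3; F2 =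
`Kato2004.mem_pSmul_of_red_eq_zero` (Kato §13.8, "`𝐇¹(T)/p𝐇¹(T) ⊂ 𝐇¹(T/p)`" on the pin) is being
discharged in the tree: its LEVELWISE half is k6-g4's `Kato2004.reduceH1_eq_zero_iff`
(`IwasawaH1ReductionKernel`), and the remaining GLOBAL half reduces (k6-g4 STATUS l.369, k6-g3 l.373)
to the statement proved here, Kato's Lemma 8.5 (2) read on the pin:

* `UniversalNorms.mem_integralH1_of_layerCores_eq_of_smul_mem` — for an elliptic curve `W/ℚ`, a prime
  `p`, the CYCLOTOMIC `ℤ_p`-extension `κ` (layers `Γ_n = Gal(ℚ̄/ℚ_n)`), and a family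
  `z_n ∈ H¹(ℚ_n, T_pW)` with `Cor z_{n+1} = z_n` (`Kato2004.layerCores`) and `p • z_n ∈ H¹(ℤ_n[1/p], T_pW)`
  (`Kato2004.integralH1`) for all `n`: every `z_n` lies in `H¹(ℤ_n[1/p], T_pW)`.

Printed source: K. Kato, Astérisque 295 (2004), **Lemma 8.5 (2)** [p. 184] "The image of
`lim←_n H¹(K(ζ_{p^n}), T) → H¹(K, T)` is contained in the image of `H¹(O_K[1/p], T) → H¹(K, T)`"
(= Rubin, *Euler Systems*, Prop. B.3.3; Perrin-Riou [Pe0, 2.2.4]).  The printed statement has no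
hypothesis on `p • z_n` and needs the Frobenius weights on the free part of `H¹(I_v, T)`; the version
here (all that F2 consumes: there `p • z_n = x_n` IS integral) replaces the weight argument by the
finiteness of the `p`-TORSION of `H¹(I_v, T_pW)`.
-- TODO(general form): Kato's Lemma 8.5 (2) without the `p`-multiple hypothesis, for a general number
-- field, `ℤ_p^d`-extensions and arbitrary `T` (Rubin B.3.3–B.3.5).

## Proof (finite group theory + the normal case of the double coset formula; no weights, no Hasse;
tools §1–§3 and the generator §5 below are in the companion file `…X9UniversalNormsTools`)

Fix `v ≠ p`, `𝔓 ∣ v`.  All inertia groups `I_𝔓'`, `𝔓' ∣ v`, lie in `ker κ ≤ Γ_m` for every `m`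
(`ZpExtension.inertia_le_kerSubgroup_holds`, Washington Prop. 13.2).
* §5 (`exists_generator`): `κ` takes ONE value `a ≠ 0` on all arithmetic Frobenius elements over `v`
  (`χ_p(Frob) = N v` by `GaloisRep.cyclotomicCharacter_apply_of_isArithFrobAt`, of infinite order, and
  `ker κ = χ_p⁻¹(torsion)` for the cyclotomic `κ`), so with `n₀ = v_p(a)`, for all `n' ≥ n₀` and `k` the
  power `φ = Frob ^ (p ^ (n'-n₀))` lies in `Γ_{n'} ∩ D_𝔓'` and its class GENERATES `Γ_{n'}/Γ_{n'+k}`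
  (above `ℚ_{n₀}` every prime over `v` is inert in `ℚ_∞`).
* §4 (`resLe_coresLe_eq_zero_of_generator`, the inert step): for `V = Γ_{n'+k} ≤ U = Γ_{n'}` with
  representatives `φ^i`, `i < p^k`, the tree's `resLe_coresLe_eq_sum_conjMap` (NSW (1.5.7), normal case)
  gives `res_{U ∩ I_𝔓'} (cor ξ) = Σ_{i<p^k} res (φ^i · ξ)`; the summands form a `p^k`-periodic
  (`φ^{p^k} ∈ V` acts trivially), SHIFT-DETERMINISTIC (`res y = 0 ⟹ res (φ·y) = 0`, `φ` normalising
  `U ∩ I_𝔓'`; b2b `Derivative.resLe_conjMap_eq_zero`) sequence of `p`-TORSION classes (`p • ξ` is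
  unramified at every `𝔓'' ∣ v`) inside the FINITE set `H¹(U ∩ I_𝔓', T_pW)[p]` (§3,
  `finite_setOf_smul_eq_zero`: a `p`-torsion class `[z]` has `p z = ∂m` and is determined by
  `m mod p ∈ W[p]`, by k6-g4's `TateModule.eq_of_prime_nsmul_eq` /
  `exists_prime_nsmul_eq_of_proj_one_eq_zero` and the finiteness of `E(ℚ̄)[p]`), hence (§1,
  `sum_range_pow_eq_zero_of_periodic`: pigeonhole gives a period `≤ #set < p^k`, the least period divides
  `p^(k-1)`) the sum is `p • (…) = 0`.
* §2 (`resLe_coresLe_eq_zero_of_forall_primesAbove`): `cor_{Γ_{n'} → Γ_n}` preserves "restriction to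
  `Γ ∩ I_𝔓'` vanishes for every `𝔓' ∣ v`" at CLASS level (per-place copy of koly's
  `TameClass.coresLe_mem_integralH1_of_inertia_le`, bsd-potss's `Kato2004/IntegralH1Corestriction`).
* §6: with `n' = n + d + 1 ≥ n₀` and `m = n' + k`, `p ^ k > #H¹(Γ_{n'} ∩ I_𝔓', T_pW)[p]`,
  norm-compatibility gives `z_{n'} = cor z_m` and `z_n = cor z_{n'}` (`eq_coresLe_add_succ`, transitivity
  `coresLe_comp`), and §4, §2 conclude.

## References

* K. Kato, *p-adic Hodge theory and values of zeta functions of modular forms*, Astérisque 295 (2004):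
  §8.2, Lemma 8.5 (pp. 180–184), §12.2 (p. 220), §13.8 (pp. 228–229). [Kato2004Asterisque]
* K. Rubin, *Euler Systems*, Ann. of Math. Stud. 147 (2000), App. B, Prop. B.3.3. [Rubin2000]
* J. Neukirch, A. Schmidt, K. Wingberg, *Cohomology of Number Fields* (2008), I §5 (1.5.6)–(1.5.7),
  Prop. 1.5.3. [NeukirchSchmidtWingberg2008]
* L. Washington, *Introduction to Cyclotomic Fields* (1997), §13.1, Prop. 13.2. [Washington1997]
* J.-P. Serre, *Abelian ℓ-adic representations and elliptic curves* (1968), Ch. I §1.1–1.2. [Serre1968]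
* J. H. Silverman, *The Arithmetic of Elliptic Curves* (2009), Cor. III.6.4. [SilvermanAEC2009]
-/

noncomputable section

open scoped NumberField Pointwise
open CategoryTheory Field IsDedekindDomain
open Literature.NumberTheory.GaloisRepresentations
open Literature.NumberTheory.EllipticCurves
open Literature.NumberTheory.EllipticCurves.ZpExtension
open Literature.NumberTheory.EllipticCurves.Kato2004
open Literature.NumberTheory.EllipticCurves.Kato2004.EulerSystemValues
open Rat.HeightOneSpectrum
open Summit.BirchSwinnertonDyer.Rank1Residual.GaloisImage

set_option linter.dupNamespace false

universe u w

namespace Summit.BirchSwinnertonDyer.BirchSwinnertonDyer.Rank1Residual.UniversalNorms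

/-! ## §4 (inert step) The inert step: `res_{U ∩ I_𝔓} ∘ cor_{V → U}` kills the classes whose `p`-multiple is
unramified at `v`, when `U/V` is cyclic of order `p ^ k` on a Frobenius of `𝔓` and `p ^ k` is large -/

section Inert

variable (W : WeierstrassCurve ℚ) [W.IsElliptic] (p : ℕ) [Fact p.Prime]
  [ContinuousSMul ℤ_[p] (W.tateModule p)]

/-- **Inert step.**  `V ⊴ Γ_ℚ` open in `U ≥ V` with `U/V` of order `p ^ k` generated by the class of an
element `φ ∈ U` of the decomposition group of `𝔓 ∣ v` (`φ • 𝔓 = 𝔓`), `I_𝔓 ≤ V`, and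
`p ^ k > #(H¹(U ∩ I_𝔓, T_pW)[p])`.  If `p • ξ` is unramified at every `𝔓' ∣ v` then
`res_{U ∩ I_𝔓} (cor_{V→U} ξ) = 0`: by the normal case of the double coset formula with representatives
`φ^i` (`resLe_coresLe_eq_sum_conjMap`), `res_{U ∩ I_𝔓} (cor ξ) = Σ_{i<p^k} res (φ^i · ξ)`, a
`p^k`-periodic shift-deterministic sequence of `p`-torsion classes, to which §1 applies.
[cite: NeukirchSchmidtWingberg2008, I §5 (1.5.6)–(1.5.7)] [cite: Kato2004Asterisque, Lemma 8.5 (pp. 183–184)] -/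
theorem resLe_coresLe_eq_zero_of_generator
    {V U : Subgroup (absoluteGaloisGroup ℚ)} [V.Normal] (h : V ≤ U)
    (hV : IsOpen (V : Set (absoluteGaloisGroup ℚ))) [Fintype (U ⧸ V.subgroupOf U)]
    {k : ℕ} (hPk : Fintype.card (U ⧸ V.subgroupOf U) = p ^ k)
    {v : HeightOneSpectrum (𝓞 ℚ)} {𝔓 : Ideal (absIntegers (𝓞 ℚ) ℚ)} (h𝔓 : 𝔓 ∈ v.primesAbove)
    (hIV : 𝔓.inertia (absoluteGaloisGroup ℚ) ≤ V)
    {φ : absoluteGaloisGroup ℚ} (hφU : φ ∈ U) (hφ𝔓 : φ • 𝔓 = 𝔓)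
    (hgen : ∀ u ∈ U, ∃ i : ℕ, (φ ^ i)⁻¹ * u ∈ V)
    (hcard : (finite_setOf_smul_eq_zero W p (U ⊓ 𝔓.inertia (absoluteGaloisGroup ℚ))).toFinset.card
      < p ^ k)
    (ξ : H1 (tateRep W p) V)
    (hξ : ∀ 𝔓' ∈ v.primesAbove, resLe (tateRep W p).toTopRep
      (inf_le_left : V ⊓ 𝔓'.inertia (absoluteGaloisGroup ℚ) ≤ V) 1 ((p : ℤ_[p]) • ξ) = 0) :
    resLe (tateRep W p).toTopRep (inf_le_left : U ⊓ 𝔓.inertia (absoluteGaloisGroup ℚ) ≤ U) 1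
      (coresLe (tateRep W p).toTopRep h hV ξ) = 0 := by
  classical
  set X := (tateRep W p).toTopRep with hX
  set P := Fintype.card (U ⧸ V.subgroupOf U) with hP
  have hp : p.Prime := Fact.out
  -- `φ ^ P ∈ V`
  have hφP : φ ^ P ∈ V := by
    have h1 : (((⟨φ, hφU⟩ : U) : U ⧸ V.subgroupOf U)) ^ P = 1 := pow_card_eq_one
    rw [← QuotientGroup.mk_pow, QuotientGroup.eq_one_iff, Subgroup.mem_subgroupOf,
      SubgroupClass.coe_pow] at h1
    exact h1
  -- the bijection `Fin P ≃ U/V`, `i ↦ [φ^i]`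
  let f : Fin P → U ⧸ V.subgroupOf U := fun i => (((⟨φ, hφU⟩ : U) ^ (i : ℕ) : U) : U ⧸ V.subgroupOf U)
  have hfsurj : Function.Surjective f := by
    intro x
    induction x using QuotientGroup.induction_on with
    | H u =>
      obtain ⟨i, hi⟩ := hgen u u.2
      have hPpos : 0 < P := Fintype.card_pos
      refine ⟨⟨i % P, Nat.mod_lt _ hPpos⟩, ?_⟩
      change (((⟨φ, hφU⟩ : U) ^ (i % P) : U) : U ⧸ V.subgroupOf U) = (u : U ⧸ V.subgroupOf U)
      rw [QuotientGroup.eq, Subgroup.mem_subgroupOf]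
      push_cast
      -- `(φ^(i % P))⁻¹ * u = (φ^P)^(i/P) * ((φ^i)⁻¹ * u) ∈ V`
      have hdecomp : (φ ^ (i % P))⁻¹ * (u : absoluteGaloisGroup ℚ) =
          (φ ^ P) ^ (i / P) * ((φ ^ i)⁻¹ * (u : absoluteGaloisGroup ℚ)) := by
        have hpow : φ ^ i = φ ^ (i % P) * (φ ^ P) ^ (i / P) := by
          rw [← pow_mul, ← pow_add, Nat.mod_add_div]
        rw [hpow, mul_inv_rev, ← mul_assoc, ← mul_assoc, mul_inv_cancel, one_mul]
      rw [hdecomp]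
      exact V.mul_mem (V.pow_mem hφP _) hi
  have hfbij : Function.Bijective f :=
    (Fintype.bijective_iff_surjective_and_card f).mpr ⟨hfsurj, by simp [hP]⟩
  let e : Fin P ≃ U ⧸ V.subgroupOf U := Equiv.ofBijective f hfbij
  let s : U ⧸ V.subgroupOf U → U := fun x => (⟨φ, hφU⟩ : U) ^ ((e.symm x : Fin P) : ℕ)
  have hs : ∀ x, (s x : U ⧸ V.subgroupOf U) = x := fun x => by
    change f (e.symm x) = x
    exact e.apply_symm_apply x
  -- `res_V (cor ξ) = Σ_{i<P} φ^i · ξ`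
  have hsum : resLe X h 1 (coresLe X h hV ξ) = ∑ i ∈ Finset.range P, conjMap X V (φ ^ i) 1 ξ := by
    rw [resLe_coresLe_eq_sum_conjMap X h hV hs ξ]
    have hsx : ∀ x, ((s x : U) : absoluteGaloisGroup ℚ) = φ ^ ((e.symm x : Fin P) : ℕ) := fun x => by
      simp only [s, SubgroupClass.coe_pow]
    simp_rw [hsx]
    rw [e.symm.sum_comp (fun i : Fin P => conjMap X V (φ ^ (i : ℕ)) 1 ξ),
      Fin.sum_univ_eq_sum_range (fun i => conjMap X V (φ ^ i) 1 ξ) P]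
  -- the sequence `a i = res_{U ∩ I_𝔓} (φ^i · ξ)`
  have hIU : U ⊓ 𝔓.inertia (absoluteGaloisGroup ℚ) ≤ V := fun g hg => hIV hg.2
  let a : ℕ → H1 (tateRep W p) (U ⊓ 𝔓.inertia (absoluteGaloisGroup ℚ)) := fun i =>
    resLe X hIU 1 (conjMap X V (φ ^ i) 1 ξ)
  have htrans : resLe X (inf_le_left : U ⊓ 𝔓.inertia (absoluteGaloisGroup ℚ) ≤ U) 1
      (coresLe X h hV ξ) = resLe X hIU 1 (resLe X h 1 (coresLe X h hV ξ)) :=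
    (Derivative.resLe_resLe X hIU h _).symm
  rw [htrans, hsum, map_sum]
  change ∑ i ∈ Finset.range P, a i = 0
  -- the hypotheses of the periodicity lemma
  have hsmul : ∀ i, (p : ℤ_[p]) • a i = 0 := by
    intro i
    change (p : ℤ_[p]) • resLe X hIU 1 (conjMap X V (φ ^ i) 1 ξ) = 0
    rw [← map_smul, ← map_smul]
    refine Derivative.resLe_conjMap_eq_zero X V (φ ^ i) hIU
      (inf_le_left : V ⊓ ((φ ^ i)⁻¹ • 𝔓).inertia (absoluteGaloisGroup ℚ) ≤ V) ?_
      (hξ _ (smul_mem_primesAbove h𝔓 (φ ^ i)⁻¹))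
    intro g hg
    refine ⟨Subgroup.Normal.conj_mem' inferInstance _ (hIV hg.2) _, ?_⟩
    have := (Ideal.conj_mem_inertia_smul_iff 𝔓 (φ ^ i)⁻¹ g).mpr hg.2
    simpa using this
  have haS : ∀ i, a i ∈ (finite_setOf_smul_eq_zero W p (U ⊓ 𝔓.inertia (absoluteGaloisGroup ℚ))).toFinset :=
    fun i => by
    rw [Set.Finite.mem_toFinset]
    exact hsmul i
  have hper : ∀ i, a (i + p ^ k) = a i := by
    intro i
    change resLe X hIU 1 (conjMap X V (φ ^ (i + p ^ k)) 1 ξ) = resLe X hIU 1 (conjMap X V (φ ^ i) 1 ξ)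
    rw [pow_add, ← conjMap_conjMap X V (φ ^ p ^ k) (φ ^ i) 1 ξ, ← hPk,
      conjMap_eq_self_of_mem_one X V hφP ξ]
  have hdet : ∀ i j, a i = a j → a (i + 1) = a (j + 1) := by
    intro i j hij
    change resLe X hIU 1 (conjMap X V (φ ^ (i + 1)) 1 ξ) = resLe X hIU 1 (conjMap X V (φ ^ (j + 1)) 1 ξ)
    rw [pow_succ', pow_succ', ← conjMap_conjMap X V (φ ^ i) φ 1 ξ, ← conjMap_conjMap X V (φ ^ j) φ 1 ξ,
      ← sub_eq_zero, ← map_sub, ← map_sub]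
    refine Derivative.resLe_conjMap_eq_zero X V φ hIU hIU ?_ ?_
    · intro g hg
      refine ⟨U.mul_mem (U.mul_mem (U.inv_mem hφU) hg.1) hφU, ?_⟩
      refine (Ideal.conj_mem_inertia_smul_iff 𝔓 φ (φ⁻¹ * g * φ)).mp ?_
      rw [hφ𝔓, show φ * (φ⁻¹ * g * φ) * φ⁻¹ = g by group]
      exact hg.2
    · rw [map_sub, sub_eq_zero]
      exact hij
  have htor : ∀ i, p • a i = 0 := fun i => by
    rw [← Nat.cast_smul_eq_nsmul ℤ_[p]]; exact hsmul i
  rw [hPk]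
  exact sum_range_pow_eq_zero_of_periodic hp a haS hcard hper hdet htor

end Inert

/-! ## §6 Assembly: Kato's Lemma 8.5 (2) in the pin's currency -/

section Assembly

variable (W : WeierstrassCurve ℚ) [W.IsElliptic] (p : ℕ) [Fact p.Prime]
  [ContinuousSMul ℤ_[p] (W.tateModule p)]

omit [W.IsElliptic] [ContinuousSMul ℤ_[p] (W.tateModule p)] in
/-- The layers `Γ_n` of a `ℤ_p`-extension have finite index in `Γ_ℚ` (open subgroups of a compact
group). [cite: Washington1997, §13.1] -/
theorem finiteIndex_layerSubgroup (κ : ZpExtension ℚ p) (n : ℕ) : (κ.layerSubgroup n).FiniteIndex :=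
  finiteIndex_of_isOpen_of_compactSpace _ (κ.isOpen_layerSubgroup n)

/-- **Iterated norm compatibility**: `z_n = cor_{Γ_{n+d+1} → Γ_n} z_{n+d+1}` for a norm-compatible
family (`layerCores`, transitivity of corestriction `coresLe_comp`).
[cite: Kato2004Asterisque, §12.2 (p. 220)] [cite: NeukirchSchmidtWingberg2008, Prop. 1.5.3] -/
theorem eq_coresLe_add_succ (κ : ZpExtension ℚ p) (z : ∀ n : ℕ, H1 (tateRep W p) (κ.layerSubgroup n))
    (hz : ∀ n, layerCores (tateRep W p) κ n (z (n + 1)) = z n) (n : ℕ) :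
    ∀ (d : ℕ) [Fintype (κ.layerSubgroup n ⧸ (κ.layerSubgroup (n + d + 1)).subgroupOf (κ.layerSubgroup n))],
      z n = coresLe (tateRep W p).toTopRep
        (κ.layerSubgroup_antitone (Nat.le_add_right n (d + 1)) :
          κ.layerSubgroup (n + d + 1) ≤ κ.layerSubgroup n)
        (κ.isOpen_layerSubgroup (n + d + 1)) (z (n + d + 1))
  | 0, inst => by
      haveI := finiteIndex_layerSubgroup p κ (n + 0 + 1)
      have e : inst = Fintype.ofFinite _ := Subsingleton.elim _ _
      subst e
      rw [← hz n]
      unfold layerCores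
      congr 1
  | d + 1, inst => by
      haveI := finiteIndex_layerSubgroup p κ (n + d + 1)
      haveI := finiteIndex_layerSubgroup p κ (n + d + 1 + 1)
      letI i1 : Fintype (κ.layerSubgroup n ⧸ (κ.layerSubgroup (n + d + 1)).subgroupOf (κ.layerSubgroup n)) :=
        Fintype.ofFinite _
      letI i2 : Fintype (κ.layerSubgroup (n + d + 1) ⧸
          (κ.layerSubgroup (n + d + 1 + 1)).subgroupOf (κ.layerSubgroup (n + d + 1))) :=
        Fintype.ofFinite _
      have ih := eq_coresLe_add_succ κ z hz n d
      have hstep : z (n + d + 1) = coresLe (tateRep W p).toTopRep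
          (κ.layerSubgroup_antitone (Nat.le_succ (n + d + 1)))
          (κ.isOpen_layerSubgroup (n + d + 1 + 1)) (z (n + d + 1 + 1)) := by
        rw [← hz (n + d + 1)]
        unfold layerCores
        congr 1
      rw [ih, hstep, ← LinearMap.comp_apply,
        coresLe_comp (tateRep W p).toTopRep (κ.layerSubgroup_antitone (Nat.le_succ (n + d + 1)))
          (κ.layerSubgroup_antitone (Nat.le_add_right n (d + 1))) (κ.isOpen_layerSubgroup (n + d + 1 + 1))
          (κ.isOpen_layerSubgroup (n + d + 1))]
      rfl

/-- **Kato 2004, Lemma 8.5 (2), in the currency of the pin `Kato2004.IwasawaH1Data` (the form used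
by the named fact F2 `Kato2004.mem_pSmul_of_red_eq_zero` of crux `MuTransferX9`).**  Let `W/ℚ` be an
elliptic curve, `p` a prime, `κ` the cyclotomic `ℤ_p`-extension with layers `ℚ_n = ℚ̄^{Γ_n}`, and
`z = (z_n)_n`, `z_n ∈ H¹(ℚ_n, T_pW)`, a NORM-COMPATIBLE family (`Cor z_{n+1} = z_n`) whose `p`-multiples
`p • z_n` are integral (unramified at every `v ≠ p`: `Kato2004.integralH1`).  Then every `z_n` is
integral.  (Printed: "The image of `lim←_n H¹(K(ζ_{p^n}), T) → H¹(K, T)` is contained in the image of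
`H¹(O_K[1/p], T) → H¹(K, T)`" [Kato, Lemma 8.5 (2), p. 184; = Rubin, *Euler Systems*, B.3.3]; the
hypothesis on `p • z_n` makes the local classes `p`-torsion and replaces the Frobenius-weight argument for
the free part of `H¹(I_v, T)`.)  PROOF: fix `v ≠ p` and `𝔓 ∣ v`; all inertia groups over `v` lie in
every `Γ_m` (`ZpExtension.inertia_le_kerSubgroup_holds`); above a layer `n₀` every prime over `v` is inert
(§5); for `n' = max n n₀ + 1` and `m = n' + k` with `p ^ k > #(H¹(Γ_{n'} ∩ I_𝔓', T_pW)[p])` (§3) the inert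
step §4 gives `res_{Γ_{n'} ∩ I_𝔓'} z_{n'} = res (cor z_m) = 0` for every `𝔓' ∣ v`, and the class-level
transport §2 along `cor_{Γ_{n'} → Γ_n}` gives `res_{Γ_n ∩ I_𝔓} z_n = 0`.
[cite: Kato2004Asterisque, Lemma 8.5 (2) (p. 184) and §13.8 (pp. 228–229)] [cite: Rubin2000, App. B Prop. B.3.3] -/
theorem mem_integralH1_of_layerCores_eq_of_smul_mem (κ : ZpExtension ℚ p) (hκ : κ.IsCyclotomic)
    (z : ∀ n : ℕ, H1 (tateRep W p) (κ.layerSubgroup n))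
    (hz : ∀ n, layerCores (tateRep W p) κ n (z (n + 1)) = z n)
    (hpz : ∀ n, ((p : ℤ_[p]) • z n) ∈ integralH1 (tateRep W p) p (κ.layerSubgroup n)) (n : ℕ) :
    z n ∈ integralH1 (tateRep W p) p (κ.layerSubgroup n) := by
  classical
  have hp : p.Prime := Fact.out
  rw [mem_integralH1_iff]
  intro v hv 𝔓 h𝔓
  have hvp : (p : 𝓞 ℚ) ∉ v.asIdeal := WeierstrassCurve.natCast_not_mem_asIdeal_of_primesEquiv_ne hp hv
  -- the inertia groups above `v` lie in every layer
  have hIle : ∀ 𝔓' ∈ v.primesAbove, ∀ m : ℕ,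
      𝔓'.inertia (absoluteGaloisGroup ℚ) ≤ κ.layerSubgroup m := fun 𝔓' h𝔓' m =>
    (ZpExtension.inertia_le_kerSubgroup_holds ℚ p κ hvp h𝔓').trans (κ.kerSubgroup_le_layerSubgroup m)
  -- generator data above the layer `n₀`
  obtain ⟨n₀, hn₀⟩ := exists_generator κ hκ hvp h𝔓
  obtain ⟨d, hd⟩ : ∃ d : ℕ, n₀ ≤ n + d + 1 := ⟨n₀, by omega⟩
  -- Step A: `z_{n'}` is unramified at every prime over `v`, `n' = n + d + 1`
  have hA : ∀ 𝔓' ∈ v.primesAbove, resLe (tateRep W p).toTopRep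
      (inf_le_left : κ.layerSubgroup (n + d + 1) ⊓ 𝔓'.inertia (absoluteGaloisGroup ℚ) ≤ _) 1
      (z (n + d + 1)) = 0 := by
    intro 𝔓' h𝔓'
    set S := (finite_setOf_smul_eq_zero W p
      (κ.layerSubgroup (n + d + 1) ⊓ 𝔓'.inertia (absoluteGaloisGroup ℚ))).toFinset with hS
    have hcard : S.card < p ^ (S.card + 1) :=
      (Nat.lt_succ_self _).trans (Nat.lt_pow_self hp.one_lt)
    obtain ⟨φ, hφ𝔓, hφU, hgen⟩ := hn₀ 𝔓' h𝔓' (n + d + 1) hd (S.card + 1)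
    haveI := finiteIndex_layerSubgroup p κ (n + d + 1 + S.card + 1)
    letI : Fintype (κ.layerSubgroup (n + d + 1) ⧸
        (κ.layerSubgroup (n + d + 1 + S.card + 1)).subgroupOf (κ.layerSubgroup (n + d + 1))) :=
      Fintype.ofFinite _
    have hle : κ.layerSubgroup (n + d + 1 + S.card + 1) ≤ κ.layerSubgroup (n + d + 1) :=
      κ.layerSubgroup_antitone (Nat.le_add_right (n + d + 1) (S.card + 1))
    have hPk : Fintype.card (κ.layerSubgroup (n + d + 1) ⧸
        (κ.layerSubgroup (n + d + 1 + S.card + 1)).subgroupOf (κ.layerSubgroup (n + d + 1))) =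
        p ^ (S.card + 1) := by
      rw [Fintype.card_eq_nat_card]
      have h1 := Subgroup.relIndex_mul_index hle
      rw [index_layerSubgroup, index_layerSubgroup] at h1
      have h2 : (κ.layerSubgroup (n + d + 1 + S.card + 1)).relIndex (κ.layerSubgroup (n + d + 1)) *
          p ^ (n + d + 1) = p ^ (S.card + 1) * p ^ (n + d + 1) := by
        rw [h1, ← pow_add]
        congr 1
        omega
      exact Nat.eq_of_mul_eq_mul_right (pow_pos hp.pos _) h2
    rw [eq_coresLe_add_succ W p κ z hz (n + d + 1) S.card]
    refine resLe_coresLe_eq_zero_of_generator W p hle (κ.isOpen_layerSubgroup _) hPk h𝔓'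
      (hIle 𝔓' h𝔓' _) hφU hφ𝔓 ?_ hcard (z (n + d + 1 + S.card + 1)) fun 𝔓'' h𝔓'' =>
        (mem_integralH1_iff _ _ _ _).mp (hpz (n + d + 1 + S.card + 1)) v hv 𝔓'' h𝔓''
    intro u hu
    obtain ⟨i, hi⟩ := hgen u hu
    exact ⟨i, by rw [add_assoc (n + d + 1)]; exact hi⟩
  -- Step B: transport along `cor_{Γ_{n'} → Γ_n}` at class level
  haveI := finiteIndex_layerSubgroup p κ (n + d + 1)
  letI : Fintype (κ.layerSubgroup n ⧸ (κ.layerSubgroup (n + d + 1)).subgroupOf (κ.layerSubgroup n)) :=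
    Fintype.ofFinite _
  rw [eq_coresLe_add_succ W p κ z hz n d]
  exact resLe_coresLe_eq_zero_of_forall_primesAbove (tateRep W p)
    (κ.layerSubgroup_antitone (Nat.le_add_right n (d + 1))) (κ.isOpen_layerSubgroup (n + d + 1))
    (fun 𝔓' h𝔓' g _ hgI => hIle 𝔓' h𝔓' _ hgI) hA h𝔓

end Assembly

end Summit.BirchSwinnertonDyer.BirchSwinnertonDyer.Rank1Residual.UniversalNorms

end
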